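import Literature.AlgebraicGeometry.Deformation.LocalHilbertFunctorKernelDimensionBound
import Literature.AlgebraicGeometry.Deformation.LocalHilbertFunctorHullComponentDimensionBound
import HarnessLib

/-!
# The KERNEL PRINCIPLE for `H_Z^X`: a compatible map `θ : H¹(Z, 𝒩_{Z/X}) → W` towards the obstruction theory of an
# UNOBSTRUCTED functor `G` bounds the hull — `h⁰(𝒩) ≤ dim R + dim ker θ`, every component — and `θ` injective ⇒ `Z` unobstructed

Layer `Literature/AlgebraicGeometry/Deformation` (family `hodge`; literature-typing tranche LT-H1 «semiregularity consumers», cell `pub-hsemireg`,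
Ventures-side typer #2; census §6 (ii)/(iv) and item (c) «σ annihilates ALL obstructions»). THEOREMS only (0 definitions, 0 named facts,
no `sorry`, no instance, no notation); imports the tree's `LocalHilbertFunctorKernelDimensionBound` (the bare kernel HYPOTHESIS
`(θ ⊗ 1)(ob) = 0` ⇒ `h⁰ ≤ dim R + dim ker θ`, `θ` injective ⇒ `J = 0`) and `LocalHilbertFunctorHullComponentDimensionBound` (per component), and
DISCHARGES that hypothesis from the printed MECHANISM behind every «semiregularity annihilates obstructions» theorem
([IaconoManetti2013SemiregularityCI, §6]; [Manetti1999DeformationTheoryDGLA, Prop. 2.17/2.18]; tree `CompatibleObstructionTheories`,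
`ObstructionTheory.IsCompatible.rTensor_ob_eq_zero_of_isSmoothSmall` — «THE KERNEL PRINCIPLE»): a morphism `ν : H_Z^X → G` to a functor `G`
SMOOTH on small extensions, an obstruction theory `(W, w_e)` of `G` and a `k`-linear `θ : H¹(Z, 𝒩_{Z/X}) → W` COMPATIBLE with `ν`
(`w_e(ν y) = (θ ⊗ 1)(ob(y))`) force every obstruction of `Z ⊂ X` into `ker θ`.

## Sources, verbatim

* [IaconoManetti2013SemiregularityCI] D. Iacono, M. Manetti, *Semiregularity and obstructions of complete intersections*, Adv. Math. 235
  (2013), Introduction (p. 2): «if the semiregularity map is injective, then the Hilbert scheme … is smooth at `Z`»; §6 (p. 14): «the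
  obstructions of the functor … are contained in the kernel of the induced map» (the morphism-to-an-unobstructed-functor mechanism).
* [Manetti1999DeformationTheoryDGLA] M. Manetti, *Deformation theory via differential graded Lie algebras*, Def. 2.14 and p. 9 (compatible
  linear maps «`w_e φ = φ′ v_e`»), Prop. 2.17, Prop. 2.18 («`F` is smooth if and only if `O_F = 0`»).
* [BuchweitzFlenner2003] Compositio 137 (2003), Thm. 7.9 (2) [arXiv p0034:L1–3] «If `Z` is compact then `dim_{[Z]} H_X ≥ dim_ℂ T¹_{X/Z}(𝒪_Z) −
  dim_ℂ ker τ`. In particular, if `τ` is injective then `H_X` is smooth at `[Z]`»; Rem. 7.11 (1); Prop. 6.13 (2) (`τ` there IS such a compatible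
  map, to the unobstructed functor of deformations of the class in Deligne/de Rham cohomology — not typed here).
* [Ran1993HodgeHilbertScheme] JDG 37 (1993), (3) + Cor. 2 «for any component `ℋ` of `Hilb_X` through `{Y}`» (per component; `π` there maps to
  the smooth germ of the Hodge locus — not typed here).
* [Hartshorne2010] Thm. 11.1, Thm. 11.3 [p0101:L11–13], §15 Ex. 15.5 (b), Cor. 9.3, §17 Thm. 17.1; [Schlessinger1968] Thm. 2.11 (1), Remark 2.10.

## What this file proves (all for `Z ⊂ X` a PROPER regular immersion of constant codimension `c` into a locally Noetherian `k`-scheme, `Z ≠ ∅`,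
## obstruction theory `localHilbertFunctor.normalObstructionTheoryOfRegularImmersion` on `H¹(Z, 𝒩_{Z/X})`; `G : ArtinFunctor k` ANY functor with
## `G.IsSmoothSmall`, `ν : ∀ R, H_Z^X(R) → G(R)` ANY family of maps, `(W, w_e)` ANY obstruction theory of `G`, `θ` compatible)

* `localHilbertFunctor_annihilates_of_isCompatible` — the kernel statement itself: every obstruction `ob(y, p)` satisfies `(θ ⊗ 1)(ob(y, p)) = 0`.
* **`localHilbertFunctor_isSmooth_of_isCompatible_of_injective`** — `θ` injective ⇒ `H_Z^X` is SMOOTH («if the semiregularity map is injective,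
  then the Hilbert scheme is smooth at `Z`», functor form).
* **`localHilbertFunctor_hull_dimension_bound_of_isCompatible`** — `dim_k ker θ < ∞` ⇒ the hull `R = k[[x_1, …, x_n]]/J` of `H_Z^X`, `n = h⁰(Z, 𝒩)`,
  has `J` generated by `≤ dim ker θ` elements and **`h⁰(Z, 𝒩_{Z/X}) ≤ dim R + dim_k ker θ`** ([BuchweitzFlenner2003, Thm. 7.9 (2)] shape).
* **`localHilbertFunctor_hullIdeal_eq_bot_of_isCompatible_of_injective`** — `θ` injective ⇒ `J = 0` (power-series hull) and `H_Z^X` smooth.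
* **`localHilbertFunctor_hull_component_dimension_bound_of_isCompatible`** — every minimal prime `𝔮` of `J`: **`h⁰ ≤ dim (k[[x]]/𝔮) + dim ker θ`**
  ([Ran1993HodgeHilbertScheme, Cor. 2] shape).
* §3 `HodgeTheory.…_smoothProjective` — the smoothness statement over `ℂ`, `X` smooth projective, `ι₀` a regular immersion of codimension `p`
  (the binders of the tree's fact `Bloch1972_hilbertScheme_smoothAt_semiregular`, which is NOT used).

HONEST SCOPE. (1) `G`, `ν`, `(W, w_e)`, `θ` are HYPOTHESES: no semiregularity map (Bloch's `π`, Buchweitz–Flenner's `τ`), no intermediate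
Jacobian ∕ Deligne-cohomology ∕ Hodge-locus functor and no proof of their unobstructedness is typed here — those are the XL inputs of
[Bloch1972Semiregularity, (7.3)], [BuchweitzFlenner2003, 7.9], [Ran1993HodgeHilbertScheme], [BandieraLepriManetti2023, Cor. 1.2]. (2) «Smooth» is
smoothness of the local Hilbert FUNCTOR; `𝒪̂_{Hilb,[Z]}` = hull is not typed. (3) `ν` need not be natural for the kernel principle (only
compatibility on small extensions is used), exactly as in the tree's `IsCompatible`. Grade: REFEREED. Nothing here asserts HC ∕ HC_CM ∕ HC_AV ∕
W₆ ∕ HC_Kum4Type, Bloch's theorem, or that any geometric map is compatible ∕ any geometric functor unobstructed.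

## References
* [IaconoManetti2013SemiregularityCI] Adv. Math. 235 (2013): Introduction, §6. [Manetti1999DeformationTheoryDGLA] Def. 2.14, Prop. 2.17, Prop. 2.18.
* [BuchweitzFlenner2003] Thm. 7.9 (2), Cor. 7.10, Rem. 7.11 (1), Prop. 6.13 (2). [Ran1993HodgeHilbertScheme] (3), Cor. 2.
* [BandieraLepriManetti2023] Cor. 1.2. [Hartshorne2010] Thm. 11.1, 11.3, Ex. 15.5 (b), Cor. 9.3, §17. [Schlessinger1968] Thm. 2.11 (1), Remark 2.10.
-/

noncomputable section

-- `(X ⊗ T).left = pullback X.hom T.hom` is `rfl` (`Over.tensorObj_left`) only at default transparency; as in the parents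
set_option backward.isDefEq.respectTransparency false -- `HilbTangentSheafNormalSheafIso.lean` ∕ Mathlib's `Cartesian.Over`

open CategoryTheory Limits IsLocalRing _root_.AlgebraicGeometry Literature.AlgebraicGeometry.Motives
open scoped TensorProduct

universe u

namespace Literature.AlgebraicGeometry.Deformation

/-! ## §1 The kernel statement from a compatible map to an unobstructed functor -/

section KernelPrinciple

variable {k : Type u} [Field k] (X : Motives.SchemeOver k) {Z : Scheme.{u}} (ι₀ : Z ⟶ X.left) [IsClosedImmersion ι₀]
  [IsLocallyNoetherian X.left] {c : ℕ} (hreg : HodgeTheory.IsRegularImmersionOfCodim ι₀ c)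
  {G : ArtinFunctor.{u} k} (ν : ∀ R : ArtAlg.{u} k, (localHilbertFunctor X ι₀.ker).obj R → G.obj R)

/-- **The kernel principle for `H_Z^X`** ([IaconoManetti2013SemiregularityCI, §6] «the obstructions of the functor … are contained in the kernel
of the induced map»): if `θ : H¹(Z, 𝒩_{Z/X}) → W` is compatible with `ν : H_Z^X → G` and an obstruction theory `(W, w_e)` of a functor `G` smooth
on small extensions, then `(θ ⊗ 1)(ob(y, p)) = 0` for every embedded deformation `y` and every small extension `p` (obstruction theory of
[Hartshorne2010, Cor. 9.3] for the regular immersion `Z ↪ X`). [cite: IaconoManetti2013SemiregularityCI, §6 (p. 14)]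
[cite: Manetti1999DeformationTheoryDGLA, Def. 2.14, Prop. 2.18] [cite: Hartshorne2010, Cor. 9.3 p. 85] -/
theorem localHilbertFunctor_annihilates_of_isCompatible {W : Type u} [AddCommGroup W] [Module k W] (OG : G.ObstructionTheory W)
    (θ : letI := normalCohomologyModuleK X ι₀ 1; HodgeTheory.normalSheafCohomology ι₀ 1 →ₗ[k] W)
    (hc : letI := normalCohomologyModuleK X ι₀ 1
      (localHilbertFunctor.normalObstructionTheoryOfRegularImmersion X ι₀ hreg).IsCompatible ν OG θ) (hG : G.IsSmoothSmall) :
    letI := normalCohomologyModuleK X ι₀ 1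
    ∀ ⦃A' A : ArtAlg.{u} k⦄ (p : A' →ₐ[k] A) (hp : IsSmallExt k p) (y : (localHilbertFunctor X ι₀.ker).obj A),
      θ.rTensor (kerₖ k p) ((localHilbertFunctor.normalObstructionTheoryOfRegularImmersion X ι₀ hreg).ob p hp y) = 0 := by
  letI := normalCohomologyModuleK X ι₀ 1
  exact fun _ _ p hp y => hc.rTensor_ob_eq_zero_of_isSmoothSmall hG p hp y

/-- **«If the semiregularity map is injective, then the Hilbert scheme is smooth at `Z`», FUNCTOR FORM, with the map and the target functor
ABSTRACT** ([IaconoManetti2013SemiregularityCI, Introduction]; [BuchweitzFlenner2003, Thm. 7.9] «In particular, if `τ` is injective then `H_X` is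
smooth at `[Z]`»): for a regular immersion `Z ↪ X` of constant codimension into a locally Noetherian `k`-scheme, a functor `G` smooth on small
extensions, `ν : H_Z^X → G`, an obstruction theory `(W, w_e)` of `G` and an INJECTIVE compatible `θ : H¹(Z, 𝒩_{Z/X}) → W`, the local Hilbert
functor `H_Z^X` is smooth (tree `localHilbertFunctor_isSmooth_of_annihilates_of_injective_of_isRegularImmersionOfCodim` fed by the kernel principle).
[cite: IaconoManetti2013SemiregularityCI, Introduction (p. 2)] [cite: BuchweitzFlenner2003, Thm. 7.9 (2), Cor. 7.10] [cite: Manetti1999DeformationTheoryDGLA, Prop. 2.17, Prop. 2.18] -/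
theorem localHilbertFunctor_isSmooth_of_isCompatible_of_injective [Nonempty Z] {W : Type u} [AddCommGroup W] [Module k W]
    (OG : G.ObstructionTheory W) (θ : letI := normalCohomologyModuleK X ι₀ 1; HodgeTheory.normalSheafCohomology ι₀ 1 →ₗ[k] W)
    (hc : letI := normalCohomologyModuleK X ι₀ 1
      (localHilbertFunctor.normalObstructionTheoryOfRegularImmersion X ι₀ hreg).IsCompatible ν OG θ) (hG : G.IsSmoothSmall)
    (hinj : Function.Injective θ) : (localHilbertFunctor X ι₀.ker).IsSmooth := by
  letI := normalCohomologyModuleK X ι₀ 1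
  exact localHilbertFunctor_isSmooth_of_annihilates_of_injective_of_isRegularImmersionOfCodim X ι₀ hreg θ
    (localHilbertFunctor_annihilates_of_isCompatible X ι₀ hreg ν OG θ hc hG) hinj

end KernelPrinciple

/-! ## §2 `Z` proper: the hull bounds from a compatible map to an unobstructed functor -/

section ProperLCI

variable {k : Type u} [Field k] (X : Motives.SchemeOver k) {Z : Scheme.{u}} (ι₀ : Z ⟶ X.left) [IsClosedImmersion ι₀]
  [IsLocallyNoetherian X.left] [IsProper (ι₀ ≫ X.hom)] [Nonempty Z] {c : ℕ} (hreg : HodgeTheory.IsRegularImmersionOfCodim ι₀ c)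
  {G : ArtinFunctor.{u} k} (ν : ∀ R : ArtAlg.{u} k, (localHilbertFunctor X ι₀.ker).obj R → G.obj R)

/-- **[BuchweitzFlenner2003, Thm. 7.9 (2)] SHAPE «`dim_{[Z]} H_X ≥ dim T¹ − dim ker τ`» from the KERNEL PRINCIPLE** (`Z ≠ ∅` a proper regular immersion
of constant codimension; `G` smooth on small extensions, `ν : H_Z^X → G`, `(W, w_e)` an obstruction theory of `G`, `θ : H¹(Z, 𝒩_{Z/X}) → W` compatible,
`dim_k ker θ < ∞`): the hull `R = k[[x_1, …, x_n]]/J` of `H_Z^X`, `n = h⁰(Z, 𝒩_{Z/X})`, `J ⊆ 𝔫²`, has `J` generated by `≤ dim_k ker θ` power series and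
**`h⁰(Z, 𝒩_{Z/X}) ≤ dim R + dim_k ker θ`** (tree `localHilbertFunctor_hull_dimension_bound_of_annihilates`). [cite: BuchweitzFlenner2003, Thm. 7.9 (2), Rem. 7.11 (1), Prop. 6.13 (2)]
[cite: IaconoManetti2013SemiregularityCI, §6 (p. 14)] [cite: Hartshorne2010, §11 Thm. 11.1 ∕ 11.3, §15 Ex. 15.5 (b), §17 Thm. 17.1] [cite: Schlessinger1968, Thm. 2.11 (1)] -/
theorem localHilbertFunctor_hull_dimension_bound_of_isCompatible {W : Type u} [AddCommGroup W] [Module k W] (OG : G.ObstructionTheory W)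
    (θ : letI := normalCohomologyModuleK X ι₀ 1; HodgeTheory.normalSheafCohomology ι₀ 1 →ₗ[k] W)
    (hfin : letI := normalCohomologyModuleK X ι₀ 1; FiniteDimensional k (LinearMap.ker θ))
    (hc : letI := normalCohomologyModuleK X ι₀ 1
      (localHilbertFunctor.normalObstructionTheoryOfRegularImmersion X ι₀ hreg).IsCompatible ν OG θ) (hG : G.IsSmoothSmall) :
    letI := normalCohomologyModuleK X ι₀ 0; letI := normalCohomologyModuleK X ι₀ 1
    ∃ (n : ℕ) (_ : n = Module.finrank k (HodgeTheory.normalSheafCohomology ι₀ 0))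
      (_ : IsNoetherianRing (MvPowerSeries (Fin n) k))
      (_ : IsAdicComplete (maximalIdeal (MvPowerSeries (Fin n) k)) (MvPowerSeries (Fin n) k))
      (st₂ : (localHilbertFunctor X ι₀.ker).TowerStage (MvPowerSeries (Fin n) k))
      (_ : IsLocalRing (HullRing.Ring (localHilbertFunctor_H1 X ι₀.ker) (ArtinFunctor.hullBaseAug (k := k) n) st₂))
      (_ : HullRing.hullIdeal (localHilbertFunctor_H1 X ι₀.ker) (ArtinFunctor.hullBaseAug (k := k) n) st₂ ≤
        maximalIdeal (MvPowerSeries (Fin n) k) ^ 2),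
      (ArtinFunctor.points (k := k) (HullRing.Ring (localHilbertFunctor_H1 X ι₀.ker) (ArtinFunctor.hullBaseAug (k := k) n) st₂)).IsNatural
        (localHilbertFunctor X ι₀.ker) (fun _ u => HullRing.eval (localHilbertFunctor_H1 X ι₀.ker) (ArtinFunctor.hullBaseAug (k := k) n) st₂ u) ∧
      (ArtinFunctor.points (k := k) (HullRing.Ring (localHilbertFunctor_H1 X ι₀.ker) (ArtinFunctor.hullBaseAug (k := k) n) st₂)).IsSmoothMap
        (localHilbertFunctor X ι₀.ker) (fun _ u => HullRing.eval (localHilbertFunctor_H1 X ι₀.ker) (ArtinFunctor.hullBaseAug (k := k) n) st₂ u) ∧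
      (Function.Bijective fun φ : HullRing.Ring (localHilbertFunctor_H1 X ι₀.ker) (ArtinFunctor.hullBaseAug (k := k) n) st₂ →ₐ[k]
          ↥(ArtAlg.sqZeroExt (k := k) k) =>
        HullRing.eval (localHilbertFunctor_H1 X ι₀.ker) (ArtinFunctor.hullBaseAug (k := k) n) st₂ φ) ∧
      (∃ s : Finset (MvPowerSeries (Fin n) k),
        Ideal.span (s : Set (MvPowerSeries (Fin n) k)) =
          HullRing.hullIdeal (localHilbertFunctor_H1 X ι₀.ker) (ArtinFunctor.hullBaseAug (k := k) n) st₂ ∧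
        s.card ≤ Module.finrank k (LinearMap.ker θ)) ∧
      (Module.finrank k (HodgeTheory.normalSheafCohomology ι₀ 0) : WithBot ℕ∞) ≤
        ringKrullDim (HullRing.Ring (localHilbertFunctor_H1 X ι₀.ker) (ArtinFunctor.hullBaseAug (k := k) n) st₂) +
          Module.finrank k (LinearMap.ker θ) := by
  letI := normalCohomologyModuleK X ι₀ 0; letI := normalCohomologyModuleK X ι₀ 1
  exact localHilbertFunctor_hull_dimension_bound_of_annihilates X ι₀ hreg θ hfin
    (localHilbertFunctor_annihilates_of_isCompatible X ι₀ hreg ν OG θ hc hG)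

/-- **[BuchweitzFlenner2003, Cor. 7.10] ∕ Bloch (7.3) HULL FORM from the KERNEL PRINCIPLE**: with `θ` INJECTIVE and compatible towards an unobstructed `G`,
the hull of `H_Z^X` is the formal power series ring in `h⁰(Z, 𝒩_{Z/X})` variables (`J = 0`) and `H_Z^X` is smooth (tree
`localHilbertFunctor_hullIdeal_eq_bot_of_annihilates_of_injective`). [cite: BuchweitzFlenner2003, Thm. 7.9 (2), Cor. 7.10, Rem. 7.11 (1)]
[cite: IaconoManetti2013SemiregularityCI, Introduction (p. 2)] [cite: Schlessinger1968, Remark 2.10, Thm. 2.11 (1)] [cite: Hartshorne2010, §17 Thm. 17.1] -/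
theorem localHilbertFunctor_hullIdeal_eq_bot_of_isCompatible_of_injective {W : Type u} [AddCommGroup W] [Module k W] (OG : G.ObstructionTheory W)
    (θ : letI := normalCohomologyModuleK X ι₀ 1; HodgeTheory.normalSheafCohomology ι₀ 1 →ₗ[k] W)
    (hc : letI := normalCohomologyModuleK X ι₀ 1
      (localHilbertFunctor.normalObstructionTheoryOfRegularImmersion X ι₀ hreg).IsCompatible ν OG θ) (hG : G.IsSmoothSmall)
    (hinj : Function.Injective θ) :
    letI := normalCohomologyModuleK X ι₀ 0
    (∃ (n : ℕ) (_ : n = Module.finrank k (HodgeTheory.normalSheafCohomology ι₀ 0))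
      (_ : IsNoetherianRing (MvPowerSeries (Fin n) k))
      (_ : IsAdicComplete (maximalIdeal (MvPowerSeries (Fin n) k)) (MvPowerSeries (Fin n) k))
      (st₂ : (localHilbertFunctor X ι₀.ker).TowerStage (MvPowerSeries (Fin n) k))
      (_ : IsLocalRing (HullRing.Ring (localHilbertFunctor_H1 X ι₀.ker) (ArtinFunctor.hullBaseAug (k := k) n) st₂)),
      HullRing.hullIdeal (localHilbertFunctor_H1 X ι₀.ker) (ArtinFunctor.hullBaseAug (k := k) n) st₂ = ⊥ ∧
      (ArtinFunctor.points (k := k) (HullRing.Ring (localHilbertFunctor_H1 X ι₀.ker) (ArtinFunctor.hullBaseAug (k := k) n) st₂)).IsNatural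
        (localHilbertFunctor X ι₀.ker) (fun _ u => HullRing.eval (localHilbertFunctor_H1 X ι₀.ker) (ArtinFunctor.hullBaseAug (k := k) n) st₂ u) ∧
      (ArtinFunctor.points (k := k) (HullRing.Ring (localHilbertFunctor_H1 X ι₀.ker) (ArtinFunctor.hullBaseAug (k := k) n) st₂)).IsSmoothMap
        (localHilbertFunctor X ι₀.ker) (fun _ u => HullRing.eval (localHilbertFunctor_H1 X ι₀.ker) (ArtinFunctor.hullBaseAug (k := k) n) st₂ u) ∧
      (Function.Bijective fun φ : HullRing.Ring (localHilbertFunctor_H1 X ι₀.ker) (ArtinFunctor.hullBaseAug (k := k) n) st₂ →ₐ[k]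
          ↥(ArtAlg.sqZeroExt (k := k) k) =>
        HullRing.eval (localHilbertFunctor_H1 X ι₀.ker) (ArtinFunctor.hullBaseAug (k := k) n) st₂ φ)) ∧
    (localHilbertFunctor X ι₀.ker).IsSmooth := by
  letI := normalCohomologyModuleK X ι₀ 0; letI := normalCohomologyModuleK X ι₀ 1
  exact localHilbertFunctor_hullIdeal_eq_bot_of_annihilates_of_injective X ι₀ hreg θ
    (localHilbertFunctor_annihilates_of_isCompatible X ι₀ hreg ν OG θ hc hG) hinj

/-- **[Ran1993HodgeHilbertScheme, (3) + Cor. 2] SHAPE «for any component `ℋ` of `Hilb_X` through `{Y}`» from the KERNEL PRINCIPLE**: with `θ` compatible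
towards an unobstructed `G` and `dim_k ker θ < ∞`, every minimal prime `𝔮` of the hull ideal `J ⊆ k[[x_1, …, x_n]]`, `n = h⁰(Z, 𝒩_{Z/X})`, has
**`h⁰(Z, 𝒩_{Z/X}) ≤ dim (k[[x]]/𝔮) + dim_k ker θ`** (tree `localHilbertFunctor_hull_component_dimension_bound_of_annihilates`).
[cite: Ran1993HodgeHilbertScheme, (3) and Cor. 2 (proof p. 194)] [cite: IaconoManetti2013SemiregularityCI, §6 (p. 14)] [cite: BuchweitzFlenner2003, Thm. 7.9 (2)]
[cite: Matsumura1987, Thm. 13.5] [cite: Hartshorne2010, §11 Thm. 11.3] -/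
theorem localHilbertFunctor_hull_component_dimension_bound_of_isCompatible {W : Type u} [AddCommGroup W] [Module k W] (OG : G.ObstructionTheory W)
    (θ : letI := normalCohomologyModuleK X ι₀ 1; HodgeTheory.normalSheafCohomology ι₀ 1 →ₗ[k] W)
    (hfin : letI := normalCohomologyModuleK X ι₀ 1; FiniteDimensional k (LinearMap.ker θ))
    (hc : letI := normalCohomologyModuleK X ι₀ 1
      (localHilbertFunctor.normalObstructionTheoryOfRegularImmersion X ι₀ hreg).IsCompatible ν OG θ) (hG : G.IsSmoothSmall) :
    letI := normalCohomologyModuleK X ι₀ 0; letI := normalCohomologyModuleK X ι₀ 1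
    ∃ (n : ℕ) (_ : n = Module.finrank k (HodgeTheory.normalSheafCohomology ι₀ 0))
      (_ : IsNoetherianRing (MvPowerSeries (Fin n) k))
      (_ : IsAdicComplete (maximalIdeal (MvPowerSeries (Fin n) k)) (MvPowerSeries (Fin n) k))
      (st₂ : (localHilbertFunctor X ι₀.ker).TowerStage (MvPowerSeries (Fin n) k))
      (_ : IsLocalRing (HullRing.Ring (localHilbertFunctor_H1 X ι₀.ker) (ArtinFunctor.hullBaseAug (k := k) n) st₂))
      (_ : HullRing.hullIdeal (localHilbertFunctor_H1 X ι₀.ker) (ArtinFunctor.hullBaseAug (k := k) n) st₂ ≤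
        maximalIdeal (MvPowerSeries (Fin n) k) ^ 2),
      (ArtinFunctor.points (k := k) (HullRing.Ring (localHilbertFunctor_H1 X ι₀.ker) (ArtinFunctor.hullBaseAug (k := k) n) st₂)).IsNatural
        (localHilbertFunctor X ι₀.ker) (fun _ u => HullRing.eval (localHilbertFunctor_H1 X ι₀.ker) (ArtinFunctor.hullBaseAug (k := k) n) st₂ u) ∧
      (Function.Bijective fun φ : HullRing.Ring (localHilbertFunctor_H1 X ι₀.ker) (ArtinFunctor.hullBaseAug (k := k) n) st₂ →ₐ[k]
          ↥(ArtAlg.sqZeroExt (k := k) k) =>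
        HullRing.eval (localHilbertFunctor_H1 X ι₀.ker) (ArtinFunctor.hullBaseAug (k := k) n) st₂ φ) ∧
      ∀ ⦃𝔮 : Ideal (MvPowerSeries (Fin n) k)⦄,
        𝔮 ∈ (HullRing.hullIdeal (localHilbertFunctor_H1 X ι₀.ker) (ArtinFunctor.hullBaseAug (k := k) n) st₂).minimalPrimes →
        (Module.finrank k (HodgeTheory.normalSheafCohomology ι₀ 0) : WithBot ℕ∞) ≤
          ringKrullDim (MvPowerSeries (Fin n) k ⧸ 𝔮) + Module.finrank k (LinearMap.ker θ) := by
  letI := normalCohomologyModuleK X ι₀ 0; letI := normalCohomologyModuleK X ι₀ 1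
  exact localHilbertFunctor_hull_component_dimension_bound_of_annihilates X ι₀ hreg θ hfin
    (localHilbertFunctor_annihilates_of_isCompatible X ι₀ hreg ν OG θ hc hG)

end ProperLCI

end Literature.AlgebraicGeometry.Deformation

/-! ## §3 Over `ℂ`, `X` smooth projective, `Z ↪ X` a regular immersion of codimension `p` (the binders of Bloch (7.3)) -/

namespace Literature.AlgebraicGeometry.HodgeTheory

open Literature.AlgebraicGeometry.Deformation Literature.AlgebraicGeometry.Motives IsLocalRing

/-- **«If the semiregularity map is injective, then the Hilbert scheme is smooth at `Z`», with the semiregularity map replaced by ANY compatible map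
towards ANY unobstructed functor** (`X` smooth projective over `ℂ` of dimension `m`, `ι₀ : Z → X` a regular immersion of codimension `p`, `Z ≠ ∅`;
`G` smooth on small extensions, `ν : H_Z^X → G`, `(W, w_e)` an obstruction theory of `G`, `θ : H¹(Z, 𝒩_{Z/X}) → W` compatible and INJECTIVE):
**`H_Z^X` is smooth** — the conclusion the tree draws from the named fact `Bloch1972_hilbertScheme_smoothAt_semiregular`
(`localHilbertFunctor_isSmooth_of_isBlochSemiregular`), here WITHOUT that fact. [cite: IaconoManetti2013SemiregularityCI, Introduction (p. 2) and §6]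
[cite: BuchweitzFlenner2003, Thm. 7.9 (2), Cor. 7.10] [cite: BandieraLepriManetti2023, §1 and Cor. 1.2] [cite: Manetti1999DeformationTheoryDGLA, Prop. 2.17, Prop. 2.18] -/
theorem localHilbertFunctor_isSmooth_of_isCompatible_of_injective_smoothProjective
    {X : Motives.SchemeOver ℂ} {m p : ℕ} (hX : Motives.IsSmoothProjective m X) {Z : Scheme.{0}} {ι₀ : Z ⟶ X.left}
    (hι : IsRegularImmersionOfCodim ι₀ p) [Nonempty Z] {G : ArtinFunctor.{0} ℂ}
    (ν : haveI := hι.isClosedImmersion; ∀ R : ArtAlg.{0} ℂ, (localHilbertFunctor X ι₀.ker).obj R → G.obj R)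
    {W : Type} [AddCommGroup W] [Module ℂ W] (OG : G.ObstructionTheory W)
    (θ : haveI := hι.isClosedImmersion; letI := normalCohomologyModuleK X ι₀ 1; normalSheafCohomology ι₀ 1 →ₗ[ℂ] W)
    (hc : haveI := hι.isClosedImmersion; letI := normalCohomologyModuleK X ι₀ 1
      haveI : IsLocallyNoetherian X.left := IsSmoothProjective.isLocallyNoetherian_holds hX
      (localHilbertFunctor.normalObstructionTheoryOfRegularImmersion X ι₀ hι).IsCompatible ν OG θ)
    (hG : G.IsSmoothSmall) (hinj : Function.Injective θ) :
    haveI := hι.isClosedImmersion; (localHilbertFunctor X ι₀.ker).IsSmooth := by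
  haveI := hι.isClosedImmersion
  haveI : IsLocallyNoetherian X.left := IsSmoothProjective.isLocallyNoetherian_holds hX
  exact localHilbertFunctor_isSmooth_of_isCompatible_of_injective X ι₀ hι ν OG θ hc hG hinj

end Literature.AlgebraicGeometry.HodgeTheory

end
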